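import Mathlib
import Summits.QuantumFields.QCD.Theorems.QuarksAsStableActionUnquenchedChessboardBoundDilutedFloor
import HarnessLib

/-!
# Sharp floor and ceiling for bond-diluted Wilson determinants (crux stmt-QuantumFields-9735, line `Sketch`)

Helper toward the lead's stub `stub_signedFloor` (RP peeling): the terminal and reference objects of
the peeling are determinants of bond-diluted operators `D_E` (`QuarksAsStableActionDefs`) whose bonds
touch only a small set `T` of sites (one or two time slices). The crude floor of
`…DilutedFloor` counts all `4N L⁴` indices with the factor `m + 4 - |S|`; the recursion of the peeling
(depth `≈ log₂ L`, each level squaring the previous bound) tolerates only the SHARP count, in which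
the isolated sites contribute exactly their bare diagonal `m + 4`:

* `bondWilsonDirac_reindex_eq_fromBlocks`, `det_bondWilsonDirac_eq_det_submatrix_mul_pow` —
  block diagonal structure (touched sites ⊕ isolated sites) and `det D_E = det (D_E|_T) · (m+4r)^k`;
* `l2_opNorm_submatrix_le` — principal submatrices do not increase the `ℓ²` operator norm;
* `pow_mul_pow_le_re_det_bondWilsonDirac` —
  `(m + 4 - |S|)^{#T-indices} (m + 4)^{#isolated indices} ≤ Re det D_E(U, m, 1)` when `|S| < m + 4`;
* `norm_det_bondWilsonDirac_le_sharp` — `|det D_E| ≤ (|m+4| + |S|)^{#T-indices} (m+4)^{#isolated}`.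

All statements are proved.
-/

noncomputable section

open Matrix Complex Finset
open Literature.MathematicalPhysics.QuantumFieldTheory Literature.MathematicalPhysics.QuantumLattice
open Literature.Probability.LatticeModels
open scoped ComplexConjugate BigOperators

namespace Summit.QuantumFields.QCD.Theorems.QuarksAsStableAction

/-! ## Sharp bounds: isolated sites contribute exactly `m + 4` -/

section Sharp

open scoped Matrix.Norms.L2Operator

variable {L N : ℕ} [NeZero L] {G : Type*} [Group G] (ρ : G →* Matrix (Fin N) (Fin N) ℂ)

/-- **Principal submatrices do not increase the `ℓ²` operator norm.** -/
theorem l2_opNorm_submatrix_le {ι : Type*} [Fintype ι] [DecidableEq ι] (q : ι → Prop)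
    [DecidablePred q] (A : Matrix ι ι ℂ) :
    ‖A.submatrix (Subtype.val : {i // q i} → ι) (Subtype.val : {i // q i} → ι)‖ ≤ ‖A‖ := by
  set P : Matrix {i // q i} ι ℂ := (1 : Matrix ι ι ℂ).submatrix Subtype.val id with hP
  have hPA : A.submatrix (Subtype.val : {i // q i} → ι) (Subtype.val : {i // q i} → ι) = P * A * Pᴴ := by
    ext s t
    simp only [hP, Matrix.submatrix_apply, Matrix.mul_apply, Matrix.conjTranspose_apply,
      Matrix.one_apply, id]
    rw [Finset.sum_eq_single (t : ι)]
    · rw [Finset.sum_eq_single (s : ι)]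
      · simp
      · intro i _ hi; simp [Ne.symm hi]
      · intro h; exact absurd (Finset.mem_univ _) h
    · intro j _ hj
      simp [Ne.symm hj]
    · intro h; exact absurd (Finset.mem_univ _) h
  have hPP : P * Pᴴ = 1 := by
    ext s t
    simp only [hP, Matrix.mul_apply, Matrix.conjTranspose_apply, Matrix.submatrix_apply,
      Matrix.one_apply, id]
    rw [Finset.sum_eq_single (t : ι)]
    · by_cases h : s = t
      · subst h; simp
      · have h' : (s : ι) ≠ (t : ι) := fun hh => h (Subtype.ext hh)
        simp [h, h']
    · intro j _ hj; simp [Ne.symm hj]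
    · intro h; exact absurd (Finset.mem_univ _) h
  have hone : ‖(1 : Matrix {i // q i} {i // q i} ℂ)‖ ≤ 1 := by
    rw [Matrix.cstar_norm_def, map_one]
    exact ContinuousLinearMap.norm_id_le
  have hPH : ‖Pᴴ‖ ≤ 1 := by
    have h := Matrix.l2_opNorm_conjTranspose_mul_self Pᴴ
    rw [Matrix.conjTranspose_conjTranspose, hPP] at h
    nlinarith [norm_nonneg Pᴴ, hone]
  have hPn : ‖P‖ ≤ 1 := by rw [← Matrix.l2_opNorm_conjTranspose]; exact hPH
  rw [hPA]
  calc ‖P * A * Pᴴ‖ ≤ ‖P * A‖ * ‖Pᴴ‖ := Matrix.l2_opNorm_mul _ _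
    _ ≤ (‖P‖ * ‖A‖) * ‖Pᴴ‖ := by gcongr; exact Matrix.l2_opNorm_mul _ _
    _ ≤ (1 * ‖A‖) * 1 := by gcongr
    _ = ‖A‖ := by ring

omit [NeZero L] in
/-- If every bond of `E` has both endpoints in `T`, an entry of the diluted operator with a row or
a column outside `T` is the bare diagonal. -/
theorem bondWilsonDirac_apply_of_not_touched (E : Finset (Edge 4 L)) (T : Finset (TorusSite 4 L))
    (hT : ∀ e ∈ E, e.1 ∈ T ∧ Site.shift e.1 e.2 ∈ T) (U : GaugeConfig 4 L G) (m r : ℝ)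
    (p q : TorusSite 4 L × Fin N × Fin 4) (h : p.1 ∉ T ∨ q.1 ∉ T) :
    bondWilsonDirac ρ E U m r p q = if p = q then ((m + 4 * r : ℝ) : ℂ) else 0 := by
  rw [bondWilsonDirac_apply]
  have hsum : (∑ μ : Fin 4,
      ((if q.1 = Site.shift p.1 μ ∧ (p.1, μ) ∈ E then
          ((r : ℂ) • (1 : Matrix (Fin 4) (Fin 4) ℂ) - euclideanGamma μ) p.2.2 q.2.2 *
            ρ (U (p.1, μ)) p.2.1 q.2.1 else 0) +
        (if p.1 = Site.shift q.1 μ ∧ (q.1, μ) ∈ E then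
          ((r : ℂ) • (1 : Matrix (Fin 4) (Fin 4) ℂ) + euclideanGamma μ) p.2.2 q.2.2 *
            ρ (U (q.1, μ))⁻¹ p.2.1 q.2.1 else 0))) = 0 := by
    refine Finset.sum_eq_zero fun μ _ => ?_
    have hf : ¬ (q.1 = Site.shift p.1 μ ∧ (p.1, μ) ∈ E) := by
      rintro ⟨h1, h2⟩
      have hp := (hT _ h2).1
      have hq : q.1 ∈ T := h1 ▸ (hT _ h2).2
      exact h.elim (fun h' => h' hp) (fun h' => h' hq)
    have hb : ¬ (p.1 = Site.shift q.1 μ ∧ (q.1, μ) ∈ E) := by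
      rintro ⟨h1, h2⟩
      have hq := (hT _ h2).1
      have hp : p.1 ∈ T := h1 ▸ (hT _ h2).2
      exact h.elim (fun h' => h' hp) (fun h' => h' hq)
    rw [if_neg hf, if_neg hb, add_zero]
  rw [hsum, mul_zero, sub_zero]

omit [NeZero L] in
/-- **Block structure**: if every bond of `E` has both endpoints in `T`, then after sorting the
indices into (sites in `T`) ⊕ (sites outside `T`) the diluted operator is block diagonal with the
scalar block `(m + 4r)·1` outside `T`. -/
theorem bondWilsonDirac_reindex_eq_fromBlocks (E : Finset (Edge 4 L)) (T : Finset (TorusSite 4 L))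
    (hT : ∀ e ∈ E, e.1 ∈ T ∧ Site.shift e.1 e.2 ∈ T) (U : GaugeConfig 4 L G) (m r : ℝ) :
    Matrix.reindex (Equiv.sumCompl (fun p : TorusSite 4 L × Fin N × Fin 4 => p.1 ∈ T)).symm (Equiv.sumCompl (fun p : TorusSite 4 L × Fin N × Fin 4 => p.1 ∈ T)).symm
        (bondWilsonDirac ρ E U m r) =
      Matrix.fromBlocks
        ((bondWilsonDirac ρ E U m r).submatrix Subtype.val Subtype.val) 0 0
        (((m + 4 * r : ℝ) : ℂ) • (1 : Matrix _ _ ℂ)) := by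
  ext (p | p) (q | q)
  · simp [Matrix.reindex_apply, Matrix.fromBlocks_apply₁₁]
  · simp only [Matrix.reindex_apply, Matrix.submatrix_apply, Equiv.symm_symm, Equiv.sumCompl_apply_inl,
      Equiv.sumCompl_apply_inr, Matrix.fromBlocks_apply₁₂, Matrix.zero_apply]
    rw [bondWilsonDirac_apply_of_not_touched ρ E T hT U m r _ _ (Or.inr q.2), if_neg]
    exact fun h => q.2 (h ▸ p.2)
  · simp only [Matrix.reindex_apply, Matrix.submatrix_apply, Equiv.symm_symm, Equiv.sumCompl_apply_inl,
      Equiv.sumCompl_apply_inr, Matrix.fromBlocks_apply₂₁, Matrix.zero_apply]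
    rw [bondWilsonDirac_apply_of_not_touched ρ E T hT U m r _ _ (Or.inl p.2), if_neg]
    exact fun h => p.2 (h ▸ q.2)
  · simp only [Matrix.reindex_apply, Matrix.submatrix_apply, Equiv.symm_symm,
      Equiv.sumCompl_apply_inr, Matrix.fromBlocks_apply₂₂, Matrix.smul_apply, Matrix.one_apply,
      smul_eq_mul]
    rw [bondWilsonDirac_apply_of_not_touched ρ E T hT U m r _ _ (Or.inl p.2)]
    by_cases h : p = q
    · subst h; simp
    · have h' : (p : TorusSite 4 L × Fin N × Fin 4) ≠ q := fun hh => h (Subtype.ext hh)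
      simp [h, h']

/-- **Determinant factorisation**: `det D_E = det (D_E|_T) · (m + 4r)^{#indices outside T}`. -/
theorem det_bondWilsonDirac_eq_det_submatrix_mul_pow (E : Finset (Edge 4 L)) (T : Finset (TorusSite 4 L))
    (hT : ∀ e ∈ E, e.1 ∈ T ∧ Site.shift e.1 e.2 ∈ T) (U : GaugeConfig 4 L G) (m r : ℝ) :
    (bondWilsonDirac ρ E U m r).det =
      ((bondWilsonDirac ρ E U m r).submatrix
          (Subtype.val : {p : TorusSite 4 L × Fin N × Fin 4 // p.1 ∈ T} → _) Subtype.val).det *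
        ((m + 4 * r : ℝ) : ℂ) ^ Fintype.card {p : TorusSite 4 L × Fin N × Fin 4 // p.1 ∉ T} := by
  classical
  have h := congrArg Matrix.det (bondWilsonDirac_reindex_eq_fromBlocks ρ E T hT U m r)
  rw [Matrix.det_reindex_self] at h
  rw [h]
  have h2 := Matrix.det_fromBlocks_zero₂₁
    ((bondWilsonDirac ρ E U m r).submatrix (Subtype.val : {p : TorusSite 4 L × Fin N × Fin 4 // p.1 ∈ T} → _) Subtype.val)
    (0 : Matrix {p : TorusSite 4 L × Fin N × Fin 4 // p.1 ∈ T} {p : TorusSite 4 L × Fin N × Fin 4 // p.1 ∉ T} ℂ)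
    (((m + 4 * r : ℝ) : ℂ) • (1 : Matrix _ _ ℂ))
  rw [Matrix.det_smul, Matrix.det_one, mul_one] at h2
  convert h2 using 2

/-- **Generic Neumann bound**: if `‖x‖ < 1` and `c > 0` then `‖(c • (1 - x))⁻¹‖ ≤ c⁻¹ (1 - ‖x‖)⁻¹`
(matrix inverse, `ℓ²` operator norm). -/
theorem norm_inv_smul_one_sub_le {n : Type*} [Fintype n] [DecidableEq n] (x : Matrix n n ℂ)
    (hx : ‖x‖ < 1) {c : ℝ} (hc : 0 < c) :
    ‖(((c : ℝ) : ℂ) • (1 - x))⁻¹‖ ≤ c⁻¹ * (1 - ‖x‖)⁻¹ := by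
  set u := Units.oneSub x hx with hu
  set ui : Matrix n n ℂ := (u⁻¹ : (Matrix n n ℂ)ˣ).val with hui
  have hone : ‖(1 : Matrix n n ℂ)‖ ≤ 1 := by
    rw [Matrix.cstar_norm_def, map_one]
    exact ContinuousLinearMap.norm_id_le
  have hinv1 : ‖ui‖ ≤ (1 - ‖x‖)⁻¹ := by
    have h := tsum_geometric_le_of_norm_lt_one x hx
    have huinv : ui = ∑' k : ℕ, x ^ k := rfl
    rw [huinv]
    linarith
  have hunit : (1 - x) = (u : Matrix _ _ ℂ) := rfl
  have hDinv : (((c : ℝ) : ℂ) • (1 - x))⁻¹ = (((c⁻¹ : ℝ)) : ℂ) • ui := by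
    refine Matrix.inv_eq_right_inv ?_
    rw [hunit, hui, smul_mul_smul_comm, Units.mul_inv, ← Complex.ofReal_mul,
      mul_inv_cancel₀ hc.ne', Complex.ofReal_one, one_smul]
  rw [hDinv, norm_smul, Complex.norm_real, Real.norm_eq_abs, abs_of_nonneg (by positivity)]
  gcongr

/-- The principal submatrix of the identity is the identity. -/
theorem one_submatrix_subtype {ι : Type*} [DecidableEq ι] (q : ι → Prop) :
    (1 : Matrix ι ι ℂ).submatrix (Subtype.val : {i // q i} → ι) (Subtype.val : {i // q i} → ι) =
      (1 : Matrix {i // q i} {i // q i} ℂ) := by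
  ext s t
  simp only [Matrix.submatrix_apply, Matrix.one_apply, Subtype.val_inj]

/-- **The sharp floor**: if the bonds of `E` lie in the directions `S`, `|S| < m + 4`, and have all
their endpoints in the site set `T`, then
`(m + 4 - |S|)^{#indices in T} · (m + 4)^{#indices outside T} ≤ Re det D_E(U, m, 1)` — the isolated
sites contribute exactly `m + 4` each (e.g. a single time slice: `(m+1)^{12L³} (m+4)^{12L³(L-1)}`). -/
theorem pow_mul_pow_le_re_det_bondWilsonDirac (hρ : ∀ g, ρ g ∈ Matrix.unitaryGroup (Fin N) ℂ)
    (E : Finset (Edge 4 L)) (U : GaugeConfig 4 L G) (S : Finset (Fin 4)) (hS : ∀ e ∈ E, e.2 ∈ S)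
    (T : Finset (TorusSite 4 L)) (hT : ∀ e ∈ E, e.1 ∈ T ∧ Site.shift e.1 e.2 ∈ T)
    {m : ℝ} (hm : (S.card : ℝ) < m + 4) :
    (m + 4 - S.card) ^ Fintype.card {p : TorusSite 4 L × Fin N × Fin 4 // p.1 ∈ T} *
        (m + 4) ^ Fintype.card {p : TorusSite 4 L × Fin N × Fin 4 // p.1 ∉ T} ≤
      ((bondWilsonDirac ρ E U m 1).det).re := by
  have hm4 : (0 : ℝ) < m + 4 := lt_of_le_of_lt (Nat.cast_nonneg _) hm
  have hgap : (0 : ℝ) < m + 4 - S.card := by linarith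
  set B : Matrix {p : TorusSite 4 L × Fin N × Fin 4 // p.1 ∈ T} {p : TorusSite 4 L × Fin N × Fin 4 // p.1 ∈ T} ℂ :=
    (bondWilsonDirac ρ E U m 1).submatrix Subtype.val Subtype.val with hB
  set k := Fintype.card {p : TorusSite 4 L × Fin N × Fin 4 // p.1 ∉ T} with hk
  -- factorisation `det D_E = det B · (m+4)^k`
  have hfac : (bondWilsonDirac ρ E U m 1).det = B.det * ((m + 4 : ℝ) : ℂ) ^ k := by
    have h := det_bondWilsonDirac_eq_det_submatrix_mul_pow ρ E T hT U m 1
    rw [show (m + 4 * (1 : ℝ)) = m + 4 by ring] at h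
    exact h
  -- `det D_E` is real and positive, hence so is `det B`
  have hposE := det_bondWilsonDirac_re_pos ρ hρ E U S hS hm
  have hrealE := det_bondWilsonDirac_eq_ofReal_re ρ hρ E U m 1
  have hck : (0 : ℝ) < (m + 4) ^ k := pow_pos hm4 _
  have hBre : (B.det).re = ((bondWilsonDirac ρ E U m 1).det).re / (m + 4) ^ k := by
    rw [hfac, ← Complex.ofReal_pow, Complex.mul_re, Complex.ofReal_re, Complex.ofReal_im, mul_zero,
      sub_zero, mul_div_assoc, div_self hck.ne', mul_one]
  have hBim : (B.det).im = 0 := by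
    have h := congrArg Complex.im hfac
    rw [← Complex.ofReal_pow, Complex.mul_im, Complex.ofReal_re, Complex.ofReal_im, mul_zero,
      zero_add] at h
    have hE : ((bondWilsonDirac ρ E U m 1).det).im = 0 := by
      rw [hrealE, Complex.ofReal_im]
    rw [hE] at h
    rcases mul_eq_zero.1 h.symm with h1 | h1
    · exact h1
    · exact absurd h1 hck.ne'
  have hBpos : 0 < (B.det).re := by rw [hBre]; exact div_pos hposE hck
  have hBnorm : ‖B.det‖ = (B.det).re := by
    rw [show B.det = (((B.det).re : ℝ) : ℂ) from Complex.ext (by simp) (by simp [hBim]),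
      Complex.norm_real, Complex.ofReal_re, Real.norm_eq_abs, abs_of_pos hBpos]
  -- Neumann bound for `B = (m+4) (1 - x)`, `x` a principal block of the masked hopping
  set K : Matrix {p : TorusSite 4 L × Fin N × Fin 4 // p.1 ∈ T} {p : TorusSite 4 L × Fin N × Fin 4 // p.1 ∈ T} ℂ :=
    (∑ μ, bondHop ρ E U μ).submatrix Subtype.val Subtype.val with hK
  have hKnorm : ‖K‖ ≤ S.card :=
    (l2_opNorm_submatrix_le _ _).trans (l2_opNorm_sum_bondHop_le ρ hρ E U S hS)
  set x : Matrix {p : TorusSite 4 L × Fin N × Fin 4 // p.1 ∈ T} {p : TorusSite 4 L × Fin N × Fin 4 // p.1 ∈ T} ℂ :=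
    ((1 / (m + 4) : ℝ) : ℂ) • K with hx
  have hxnorm : ‖x‖ ≤ S.card / (m + 4) := by
    rw [hx, norm_smul, Complex.norm_real, Real.norm_eq_abs, abs_of_nonneg (by positivity)]
    calc 1 / (m + 4) * ‖K‖ ≤ 1 / (m + 4) * S.card := by gcongr
      _ = S.card / (m + 4) := by ring
  have hx1 : ‖x‖ < 1 := hxnorm.trans_lt (by rw [div_lt_one hm4]; exact hm)
  have hBx : B = ((m + 4 : ℝ) : ℂ) • (1 - x) := by
    have hc : ((m + 4 : ℝ) : ℂ) * (((1 / (m + 4) : ℝ)) : ℂ) = 1 := by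
      rw [← Complex.ofReal_mul, show (m + 4) * (1 / (m + 4)) = 1 by field_simp, Complex.ofReal_one]
    ext s t
    rw [hB, Matrix.submatrix_apply, bondWilsonDirac_eq_sub_sum_bondHop ρ hρ E U m, Matrix.sub_apply,
      Matrix.smul_apply, Matrix.one_apply, Matrix.smul_apply, Matrix.sub_apply, Matrix.one_apply, hx,
      Matrix.smul_apply, hK, Matrix.submatrix_apply, smul_eq_mul, smul_eq_mul, smul_eq_mul, mul_sub,
      ← mul_assoc, hc, one_mul]
    simp only [Subtype.val_inj]
  have hinv : ‖B⁻¹‖ ≤ (m + 4 - S.card)⁻¹ := by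
    rw [hBx]
    refine (norm_inv_smul_one_sub_le x hx1 hm4).trans ?_
    have h1x : 0 < 1 - ‖x‖ := by linarith
    rw [← mul_inv]
    rw [inv_le_inv₀ (mul_pos hm4 h1x) hgap]
    have : (m + 4) * (1 - S.card / (m + 4)) = m + 4 - S.card := by field_simp
    calc m + 4 - S.card = (m + 4) * (1 - S.card / (m + 4)) := this.symm
      _ ≤ (m + 4) * (1 - ‖x‖) := by gcongr
  have hunit : IsUnit B.det := by
    rw [isUnit_iff_ne_zero]
    intro h0
    have : (B.det).re = 0 := by rw [h0, Complex.zero_re]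
    linarith
  have hfloorB := UnquenchedChessboardBoundLine.pow_le_norm_det_of_norm_inv_le B hunit hgap hinv
  rw [hBnorm] at hfloorB
  -- assemble
  have hre : ((bondWilsonDirac ρ E U m 1).det).re = (B.det).re * (m + 4) ^ k := by
    rw [hBre, div_mul_cancel₀ _ hck.ne']
  rw [hre]
  exact mul_le_mul_of_nonneg_right hfloorB hck.le

/-- **The sharp upper bound**: under the same support hypotheses,
`|det D_E(U, m, 1)| ≤ (|m + 4| + |S|)^{#indices in T} · (m + 4)^{#indices outside T}` (for `m + 4 > 0`). -/
theorem norm_det_bondWilsonDirac_le_sharp (hρ : ∀ g, ρ g ∈ Matrix.unitaryGroup (Fin N) ℂ)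
    (E : Finset (Edge 4 L)) (U : GaugeConfig 4 L G) (S : Finset (Fin 4)) (hS : ∀ e ∈ E, e.2 ∈ S)
    (T : Finset (TorusSite 4 L)) (hT : ∀ e ∈ E, e.1 ∈ T ∧ Site.shift e.1 e.2 ∈ T)
    {m : ℝ} (hm4 : 0 < m + 4) :
    ‖(bondWilsonDirac ρ E U m 1).det‖ ≤
      (|m + 4| + S.card) ^ Fintype.card {p : TorusSite 4 L × Fin N × Fin 4 // p.1 ∈ T} *
        (m + 4) ^ Fintype.card {p : TorusSite 4 L × Fin N × Fin 4 // p.1 ∉ T} := by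
  set B : Matrix {p : TorusSite 4 L × Fin N × Fin 4 // p.1 ∈ T} {p : TorusSite 4 L × Fin N × Fin 4 // p.1 ∈ T} ℂ :=
    (bondWilsonDirac ρ E U m 1).submatrix Subtype.val Subtype.val with hB
  have hfac : (bondWilsonDirac ρ E U m 1).det =
      B.det * ((m + 4 : ℝ) : ℂ) ^ Fintype.card {p : TorusSite 4 L × Fin N × Fin 4 // p.1 ∉ T} := by
    have h := det_bondWilsonDirac_eq_det_submatrix_mul_pow ρ E T hT U m 1
    rw [show (m + 4 * (1 : ℝ)) = m + 4 by ring] at h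
    exact h
  have hone : ‖(1 : Matrix {p : TorusSite 4 L × Fin N × Fin 4 // p.1 ∈ T}
      {p : TorusSite 4 L × Fin N × Fin 4 // p.1 ∈ T} ℂ)‖ ≤ 1 := by
    rw [Matrix.cstar_norm_def, map_one]
    exact ContinuousLinearMap.norm_id_le
  have hBnorm : ‖B‖ ≤ |m + 4| + S.card := by
    have hBeq : B = ((m + 4 : ℝ) : ℂ) • (1 : Matrix _ _ ℂ) -
        (∑ μ, bondHop ρ E U μ).submatrix Subtype.val Subtype.val := by
      ext s t
      rw [hB, Matrix.submatrix_apply, bondWilsonDirac_eq_sub_sum_bondHop ρ hρ E U m, Matrix.sub_apply,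
        Matrix.smul_apply, Matrix.one_apply, Matrix.sub_apply, Matrix.smul_apply, Matrix.one_apply,
        Matrix.submatrix_apply]
      simp only [Subtype.val_inj]
    rw [hBeq]
    refine (norm_sub_le _ _).trans (add_le_add ?_ ?_)
    · rw [norm_smul, Complex.norm_real, Real.norm_eq_abs]
      calc |m + 4| * ‖(1 : Matrix _ _ ℂ)‖ ≤ |m + 4| * 1 := by gcongr
        _ = |m + 4| := mul_one _
    · exact (l2_opNorm_submatrix_le _ _).trans (l2_opNorm_sum_bondHop_le ρ hρ E U S hS)
  have hdetB : ‖B.det‖ ≤ (|m + 4| + S.card) ^ Fintype.card {p : TorusSite 4 L × Fin N × Fin 4 // p.1 ∈ T} :=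
    (UnquenchedChessboardBoundLine.norm_det_le_opNorm_pow B).trans
      (pow_le_pow_left₀ (norm_nonneg _) hBnorm _)
  rw [hfac, norm_mul, ← Complex.ofReal_pow, Complex.norm_real, Real.norm_eq_abs,
    abs_of_pos (pow_pos hm4 _)]
  exact mul_le_mul_of_nonneg_right hdetB (pow_pos hm4 _).le

end Sharp

end Summit.QuantumFields.QCD.Theorems.QuarksAsStableAction

end
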